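import Summits.ABC.ABC.Theorems.CuspFieldPencilNFPencilThreeFormsLemmas
import Literature.NumberTheory.DiophantineGeometry.AbcScoones2021NumberFields
import HarnessLib

/-!
# Three `𝓞_K`-linear forms in coprime integers: the exponent-`1/3 + ε` bound from Scoones 2021

`Summits/ABC/ABC/Theorems/CuspFieldPencilNFPencilThreeForms.lean` — LINE 17 step (5)(A), helper
toward the crux stmt-ABC-26250 `Summit.ABC.ABC.Theses.CuspFieldPencil.NFPencilBound` (draft
class-record route `CuspFieldPencil`; the item stays OPEN as typed — it is the UNCONDITIONAL
statement; nothing here restates it). ROUTE-INDEPENDENT: this module imports no `Theses` file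
(only the lemmas file `CuspFieldPencilNFPencilThreeFormsLemmas.lean` and the fact module), so any
other ℤ-shadow of the same number-field fact (e.g. the `ℚ(i)` row) can import it without pulling a
route file into its cone.

* `NFPencilThreeForms.threeForms_of_scoones2021` — the registered stub `stub_threeForms` (three
  pairwise non-proportional `𝓞_K`-linear forms over a class-number-one `K`, exponent `1/3 + ε`)
  PROVED MODULO the named fact
  `Literature.NumberTheory.DiophantineGeometry.scoones2021_abcNumberField_classNumberOne`
  (Scoones, Mathematika 70 (2023) Thm 3 = arXiv:2111.07791, cite-only, consumed BY NAME as the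
  hypothesis `hS`). SAME STATEMENT as `NFPencilOfScoones.threeForms_of_scoones2021`
  (`CuspFieldPencilNFPencilOfScoones.lean`, abc-harv-pr-4, landed in parallel), independent proof
  with a route-independent import cone; the modus ponens to `NFPencilBound` (all `k ≥ 3`) is the
  landed `Summit.ABC.ABC.Theorems.nfPencilBound_of_scoones2021` (=
  `nfPencilBound_of_threeForms ∘` three forms) and is NOT repeated here.

**Proof of the three-forms case** (lemmas: the route-independent file
`CuspFieldPencilNFPencilThreeFormsLemmas.lean`, namespace `NFPencilThreeForms`, §§1–5). With
`δᵢⱼ = αᵢβⱼ − αⱼβᵢ ≠ 0` the forms satisfy `δ₁₂L₀ + δ₂₀L₁ + δ₀₁L₂ = 0` (§1). In the PID `𝓞_K` write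
`δ₁₂L₀ = g·a`, `δ₂₀L₁ = g·b` with `(a, b) = 1` (§2, `g` a generator of the ideal
`(δ₁₂L₀, δ₂₀L₁)`), `c = −a − b`, so
`δ₀₁L₂ = g·c` and `a + b + c = 0` is a pairwise coprime nonzero `𝓞_K`-triple: the fact gives
`log H_K(a:b:c) ≤ C_S · N_K(a,b,c)^{1/3+ε}`. §3: every bad prime of `(a:b:c)` divides
`λ·L₀L₁L₂` (`λ = δ₁₂δ₂₀δ₀₁`), so `N_K(a,b,c) ≤ N(rad(λL₀L₁L₂ 𝓞_K)) ≤ N(rad λ)·G₀G₁G₂`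
(tree `radicalNorm_le_absNorm_span`; `N(rad(IJ)) ≤ N(rad I)N(rad J)`). §4 (heights, Mathlib's
relative `Height.mulHeight` via `NumberField.mulHeight_eq` /
`absNorm_mul_finprod_finitePlace_eq_one`): `H_K(a:b:c) = H_K(x)` for `x = (δ₁₂L₀, δ₂₀L₁, δ₀₁L₂)`
(projective invariance), and `λu`, `λw` are fixed `𝓞_K`-combinations of `x₀, x₁` with
`λ ∈ (x₀, x₁)` (as `(u, w) = 1`), whence at each embedding `|σλ|·|u| ≤ E_σ · maxᵢ|σxᵢ|`, and
multiplying over `σ` (the non-archimedean part of `H_K(x)` is `N((x₀,x₁,x₂))⁻¹ ≥ |N(λ)|⁻¹`):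
`max(|u|,|w|)^[K:ℚ] ≤ E · H_K(x)`. §5: `[K:ℚ] log max(|u|,|w|) ≤ log E + C_S N(rad λ)^{1/3+ε}
(G₀G₁G₂)^{1/3+ε}`, and `G₀G₁G₂ ≥ 1`.

HONESTY. CONDITIONAL result (PROVED-MOD-FACT {scoones2021_abcNumberField_classNumberOne}); the
hypothesis is an unconditional theorem in print typed as a cite-only named fact (no proof in the
tree; Baker's method over number fields). Bookkeeping of a CLASS RECORD at abc distance 0 (width
0): NOT abc, NOT A-PS, no rung; abc moved by 0; PROVED-MOD-FACT ≠ proved; typed ≠ proved.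

References: A. Scoones, *On the abc conjecture in algebraic number fields*, Mathematika 70 (2023)
= arXiv:2111.07791, Thm 3 and the display after it (p. 4) [Scoones2023]; Granville–Stark, Invent.
Math. 139 (2000) §2 (conductor vs norm; tree file `AbcWave0GranvilleStarkHeights`); [folklore].
-/

set_option linter.dupNamespace false

namespace Summit.ABC.ABC.Theorems

open NumberField Height
open Literature.NumberTheory.DiophantineGeometry

namespace NFPencilThreeForms

/-- **THREE FORMS (the registered stub `stub_threeForms` of stmt-ABC-26250, PROVED MODULO the named
fact `scoones2021_abcNumberField_classNumberOne`).** For a class-number-one number field `K`, three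
pairwise non-proportional linear forms `Lᵢ = αᵢu + βᵢw` over `𝓞_K` and `ε > 0` there is `C` with
`log max(|u|,|w|) ≤ C·(G₀G₁G₂)^{1/3+ε}` for all coprime `u, w ∈ ℤ` with `L₀L₁L₂(u,w) ≠ 0`,
`Gᵢ = N(rad(Lᵢ(u,w)𝓞_K))`. Proof: the dependency `δ₁₂L₀ + δ₂₀L₁ + δ₀₁L₂ = 0` (fixed nonzero minors),
division by `g = gcd(δ₁₂L₀, δ₂₀L₁)` in the PID gives a pairwise coprime `𝓞_K`-triple `a + b + c = 0`;
Scoones: `log H_K(a:b:c) ≤ C_S·N^{1/3+ε}` with `N = radicalNorm ≤ N(rad(δ₁₂δ₂₀δ₀₁)) · G₀G₁G₂`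
(every bad prime divides `δ₁₂δ₂₀δ₀₁·L₀L₁L₂`); heights: `H_K(a:b:c) = H_K(δ₁₂L₀ : δ₂₀L₁ : δ₀₁L₂)`
(projective invariance) and `δ₁₂δ₂₀δ₀₁·u`, `δ₁₂δ₂₀δ₀₁·w` are fixed `𝓞_K`-combinations of
`δ₁₂L₀, δ₂₀L₁` with `δ₁₂δ₂₀δ₀₁ ∈ (δ₁₂L₀, δ₂₀L₁)` (as `(u, w) = 1`), so
`[K:ℚ]·log max(|u|,|w|) ≤ log H_K + O_forms(1)` (`abs_pow_finrank_le_mulHeight`). CONDITIONAL on the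
cite-only fact (Scoones, Mathematika 70 (2023) Thm 3, arXiv:2111.07791); NOT abc; abc moved by 0.
[cite: Scoones2023, Thm 3 + display p. 4] -/
theorem threeForms_of_scoones2021 (hS : scoones2021_abcNumberField_classNumberOne) :
    ∀ (K : Type) [Field K] [NumberField K], IsPrincipalIdealRing (𝓞 K) →
      ∀ (α β : Fin 3 → 𝓞 K), (∀ i j, i ≠ j → α i * β j ≠ α j * β i) → ∀ ε : ℝ, 0 < ε →
        ∃ C : ℝ, ∀ u w : ℤ, IsCoprime u w →
          (∏ i, (α i * (u : 𝓞 K) + β i * (w : 𝓞 K))) ≠ 0 →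
            Real.log ((max |u| |w| : ℤ) : ℝ) ≤ C *
              ((∏ i, Ideal.absNorm (Ideal.span {α i * (u : 𝓞 K) + β i * (w : 𝓞 K)}).radical : ℕ) : ℝ) ^
                (1 / (3 : ℝ) + ε) := by
  intro K _ _ hPID α β hprop ε hε
  classical
  haveI := hPID
  obtain ⟨CS, hCS0, hSK⟩ := hS K hPID ε hε
  -- the three minors: fixed nonzero coefficients of the dependency
  obtain ⟨l0, hl0⟩ : ∃ l0 : 𝓞 K, l0 = α 1 * β 2 - α 2 * β 1 := ⟨_, rfl⟩
  obtain ⟨l1, hl1⟩ : ∃ l1 : 𝓞 K, l1 = α 2 * β 0 - α 0 * β 2 := ⟨_, rfl⟩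
  obtain ⟨l2, hl2⟩ : ∃ l2 : 𝓞 K, l2 = α 0 * β 1 - α 1 * β 0 := ⟨_, rfl⟩
  have hl0' : l0 ≠ 0 := by rw [hl0]; exact sub_ne_zero.mpr (hprop 1 2 (by decide))
  have hl1' : l1 ≠ 0 := by rw [hl1]; exact sub_ne_zero.mpr (hprop 2 0 (by decide))
  have hl2' : l2 ≠ 0 := by rw [hl2]; exact sub_ne_zero.mpr (hprop 0 1 (by decide))
  obtain ⟨l, hl⟩ : ∃ l : 𝓞 K, l = l0 * l1 * l2 := ⟨_, rfl⟩
  have hl' : l ≠ 0 := by rw [hl]; exact mul_ne_zero (mul_ne_zero hl0' hl1') hl2'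
  -- the constants
  obtain ⟨cu, hcu0, hcu1, hcu2⟩ : ∃ cu : Fin 3 → 𝓞 K, cu 0 = l1 * β 1 ∧ cu 1 = -(l0 * β 0) ∧ cu 2 = 0 :=
    ⟨![l1 * β 1, -(l0 * β 0), 0], rfl, rfl, rfl⟩
  obtain ⟨cw, hcw0, hcw1, hcw2⟩ : ∃ cw : Fin 3 → 𝓞 K, cw 0 = -(l1 * α 1) ∧ cw 1 = l0 * α 0 ∧ cw 2 = 0 :=
    ⟨![-(l1 * α 1), l0 * α 0, 0], rfl, rfl, rfl⟩
  obtain ⟨Eu, hEu⟩ : ∃ Eu : ℝ, Eu = ∏ φ : K →+* ℂ, ∑ i, ‖φ (cu i)‖ := ⟨_, rfl⟩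
  obtain ⟨Ew, hEw⟩ : ∃ Ew : ℝ, Ew = ∏ φ : K →+* ℂ, ∑ i, ‖φ (cw i)‖ := ⟨_, rfl⟩
  have hEu0 : 0 ≤ Eu :=
    hEu ▸ Finset.prod_nonneg fun φ _ => Finset.sum_nonneg fun i _ => norm_nonneg _
  have hEw0 : 0 ≤ Ew :=
    hEw ▸ Finset.prod_nonneg fun φ _ => Finset.sum_nonneg fun i _ => norm_nonneg _
  obtain ⟨Nl, hNl⟩ : ∃ Nl : ℕ, Nl = Ideal.absNorm (Ideal.span {l}).radical := ⟨_, rfl⟩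
  have he0 : 0 ≤ 1 / (3 : ℝ) + ε := by positivity
  refine ⟨(|Real.log (Eu + Ew + 1)| + CS * (Nl : ℝ) ^ (1 / (3 : ℝ) + ε)), ?_⟩
  intro u w hcop hprod
  -- the forms
  obtain ⟨L, hL⟩ : ∃ L : Fin 3 → 𝓞 K, ∀ i, α i * (u : 𝓞 K) + β i * (w : 𝓞 K) = L i :=
    ⟨_, fun i => rfl⟩
  simp only [hL] at hprod ⊢
  have hLi : ∀ i, L i ≠ 0 := fun i hi => hprod (Finset.prod_eq_zero (Finset.mem_univ i) hi)
  -- the dependent triple `x = (l0 L0, l1 L1, l2 L2)`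
  obtain ⟨x, hx0, hx1, hx2⟩ : ∃ x : Fin 3 → 𝓞 K, x 0 = l0 * L 0 ∧ x 1 = l1 * L 1 ∧ x 2 = l2 * L 2 :=
    ⟨![l0 * L 0, l1 * L 1, l2 * L 2], rfl, rfl, rfl⟩
  have hx0' : x 0 ≠ 0 := by rw [hx0]; exact mul_ne_zero hl0' (hLi 0)
  have hx1' : x 1 ≠ 0 := by rw [hx1]; exact mul_ne_zero hl1' (hLi 1)
  have hx2' : x 2 ≠ 0 := by rw [hx2]; exact mul_ne_zero hl2' (hLi 2)
  have hxne : x ≠ 0 := fun h => hx0' (by rw [h, Pi.zero_apply])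
  have hsum : x 0 + x 1 + x 2 = 0 := by
    rw [hx0, hx1, hx2, hl0, hl1, hl2, ← hL 0, ← hL 1, ← hL 2]
    exact cyclic_identity α β (u : 𝓞 K) (w : 𝓞 K)
  have hmu := minor_mul_left α β (u : 𝓞 K) (w : 𝓞 K)
  have hmw := minor_mul_right α β (u : 𝓞 K) (w : 𝓞 K)
  rw [hL 0, hL 1, ← hl2] at hmu hmw
  -- `l·u` and `l·w` are fixed combinations of `x 0, x 1`
  have hlu : l * (u : 𝓞 K) = ∑ i, cu i * x i := by
    rw [Fin.sum_univ_three, hcu0, hcu1, hcu2, hx0, hx1, hx2]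
    linear_combination (l0 * l1) * hmu + (u : 𝓞 K) * hl
  have hlw : l * (w : 𝓞 K) = ∑ i, cw i * x i := by
    rw [Fin.sum_univ_three, hcw0, hcw1, hcw2, hx0, hx1, hx2]
    linear_combination (l0 * l1) * hmw + (w : 𝓞 K) * hl
  -- `l ∈ (x 0, x 1, x 2)` since `(u, w) = 1`
  have hlmem : l ∈ Ideal.span (Set.range x) := by
    obtain ⟨p, q, hpq⟩ := hcop
    have hpq' : (p : 𝓞 K) * (u : 𝓞 K) + (q : 𝓞 K) * (w : 𝓞 K) = 1 := by exact_mod_cast congrArg (fun z : ℤ => (z : 𝓞 K)) hpq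
    have h1 : l = (p : 𝓞 K) * (l * (u : 𝓞 K)) + (q : 𝓞 K) * (l * (w : 𝓞 K)) := by
      linear_combination (-l) * hpq'
    rw [h1, hlu, hlw]
    refine Ideal.add_mem _ (Ideal.mul_mem_left _ _ (Ideal.sum_mem _ fun i _ => ?_))
      (Ideal.mul_mem_left _ _ (Ideal.sum_mem _ fun i _ => ?_))
    · exact Ideal.mul_mem_left _ _ (Ideal.subset_span ⟨i, rfl⟩)
    · exact Ideal.mul_mem_left _ _ (Ideal.subset_span ⟨i, rfl⟩)
  -- height lower bounds
  have hu := abs_pow_finrank_le_mulHeight hxne hl' hlmem hlu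
  have hw := abs_pow_finrank_le_mulHeight hxne hl' hlmem hlw
  rw [← hEu] at hu
  rw [← hEw] at hw
  have hHpos : 0 < mulHeight (fun i => (x i : K)) := mulHeight_pos _
  have hmax := max_pow_le hEu0 hEw0 hHpos.le hu hw
  -- division by the gcd in the PID
  obtain ⟨g, a, b, hga, hgb, hab⟩ := exists_eq_mul_isCoprime (x 0) (x 1) hx0'
  obtain ⟨c, hc⟩ : ∃ c : 𝓞 K, c = -(a + b) := ⟨_, rfl⟩
  have habc : a + b + c = 0 := by rw [hc]; ring
  have hgc : x 2 = g * c := by rw [hc]; linear_combination hsum - hga - hgb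
  have hg0 : g ≠ 0 := fun h => hx0' (by rw [hga, h, zero_mul])
  have ha0 : a ≠ 0 := fun h => hx0' (by rw [hga, h, mul_zero])
  have hb0 : b ≠ 0 := fun h => hx1' (by rw [hgb, h, mul_zero])
  have hc0 : c ≠ 0 := fun h => hx2' (by rw [hgc, h, mul_zero])
  have hbc := isCoprime_of_add_add_eq_zero_left habc hab
  have hca := isCoprime_of_add_add_eq_zero_right habc hab
  -- Scoones on the reduced triple
  have hSabc := hSK a b c ha0 hb0 hc0 habc hab hbc hca
  -- projective invariance: `H_K(a:b:c) = H_K(x)`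
  have hgK : (g : K) ≠ 0 := by exact_mod_cast hg0
  have hvec : (fun i => (x i : K)) = (g : K) • ![(a : K), (b : K), (c : K)] := by
    have e0 : ((x 0 : 𝓞 K) : K) = (g : K) * (a : K) := by rw [hga]; simp only [map_mul]
    have e1 : ((x 1 : 𝓞 K) : K) = (g : K) * (b : K) := by rw [hgb]; simp only [map_mul]
    have e2 : ((x 2 : 𝓞 K) : K) = (g : K) * (c : K) := by rw [hgc]; simp only [map_mul]
    funext i
    fin_cases i <;> simp [e0, e1, e2]
  have hHeq : mulHeight ![(a : K), (b : K), (c : K)] = mulHeight (fun i => (x i : K)) := by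
    rw [hvec, mulHeight_smul_eq_mulHeight _ hgK]
  -- the radical norm of the reduced triple
  have hP0 : l * (L 0 * L 1 * L 2) ≠ 0 :=
    mul_ne_zero hl' (mul_ne_zero (mul_ne_zero (hLi 0) (hLi 1)) (hLi 2))
  have hdiv0 : x 0 ∣ l * (L 0 * L 1 * L 2) := ⟨l1 * l2 * (L 1 * L 2), by rw [hx0, hl]; ring⟩
  have hdiv1 : x 1 ∣ l * (L 0 * L 1 * L 2) := ⟨l0 * l2 * (L 0 * L 2), by rw [hx1, hl]; ring⟩
  have hdiv2 : x 2 ∣ l * (L 0 * L 1 * L 2) := ⟨l0 * l1 * (L 0 * L 1), by rw [hx2, hl]; ring⟩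
  have hrad : radicalNorm (a : K) (b : K) (c : K) ≤
      Nl * ∏ i, Ideal.absNorm (Ideal.span {L i}).radical := by
    refine (radicalNorm_le_absNorm_radical hPID hP0 ((Dvd.intro_left g hga.symm).trans hdiv0)
      ((Dvd.intro_left g hgb.symm).trans hdiv1) ((Dvd.intro_left g hgc.symm).trans hdiv2)).trans ?_
    rw [Fin.prod_univ_three, hNl]
    refine (absNorm_radical_span_mul_le hl' (mul_ne_zero (mul_ne_zero (hLi 0) (hLi 1)) (hLi 2))).trans
      (Nat.mul_le_mul_left _ ?_)
    refine (absNorm_radical_span_mul_le (mul_ne_zero (hLi 0) (hLi 1)) (hLi 2)).trans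
      (Nat.mul_le_mul_right _ ?_)
    exact absNorm_radical_span_mul_le (hLi 0) (hLi 1)
  -- bookkeeping
  set G : ℝ := ((∏ i, Ideal.absNorm (Ideal.span {L i}).radical : ℕ) : ℝ) with hG
  have hGpos : 0 < ∏ i, Ideal.absNorm (Ideal.span {L i}).radical := by
    refine Finset.prod_pos fun i _ => Nat.pos_of_ne_zero ?_
    rw [Ne, Ideal.absNorm_eq_zero_iff]
    intro h
    have : Ideal.span {L i} = ⊥ := le_bot_iff.mp (Ideal.le_radical.trans h.le)
    exact hLi i (Ideal.span_singleton_eq_bot.mp this)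
  have hG1 : 1 ≤ G := by rw [hG]; exact_mod_cast hGpos
  have hG0 : 0 ≤ G := zero_le_one.trans hG1
  have hNl0 : (0 : ℝ) ≤ Nl := Nat.cast_nonneg _
  have hrad' : (radicalNorm (a : K) (b : K) (c : K) : ℝ) ≤ (Nl : ℝ) * G := by
    rw [hG]; exact_mod_cast hrad
  have hX : 1 ≤ G ^ (1 / (3 : ℝ) + ε) := Real.one_le_rpow hG1 he0
  have hlog : Real.log (mulHeight (fun i => (x i : K))) ≤
      (CS * (Nl : ℝ) ^ (1 / (3 : ℝ) + ε)) * G ^ (1 / (3 : ℝ) + ε) := by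
    rw [← hHeq]
    calc Real.log (mulHeight ![(a : K), (b : K), (c : K)])
        = logHeight ![(a : K), (b : K), (c : K)] := rfl
      _ ≤ CS * (radicalNorm (a : K) (b : K) (c : K) : ℝ) ^ (1 / 3 + ε : ℝ) := hSabc
      _ ≤ CS * (((Nl : ℝ) * G) ^ (1 / (3 : ℝ) + ε)) := by
          refine mul_le_mul_of_nonneg_left ?_ hCS0.le
          exact Real.rpow_le_rpow (Nat.cast_nonneg _) hrad' he0
      _ = (CS * (Nl : ℝ) ^ (1 / (3 : ℝ) + ε)) * G ^ (1 / (3 : ℝ) + ε) := by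
          rw [Real.mul_rpow hNl0 hG0]; ring
  have hB0 : 0 ≤ CS * (Nl : ℝ) ^ (1 / (3 : ℝ) + ε) :=
    mul_nonneg hCS0.le (Real.rpow_nonneg hNl0 _)
  have hF : 0 < Eu + Ew + 1 := by positivity
  have hn : Module.finrank ℚ K ≠ 0 := Module.finrank_pos.ne'
  have hM : (0 : ℤ) ≤ max |u| |w| := le_max_of_le_left (abs_nonneg u)
  exact log_le_of_pow_le hn hM hF hHpos hB0 hX hmax hlog

end NFPencilThreeForms

end Summit.ABC.ABC.Theorems
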